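import Mathlib.Analysis.Calculus.ImplicitContDiff
import Mathlib.Analysis.Complex.Basic
import Literature.Analysis.Calculus.LevelSetTangentFamilies

/-!
# A non-degenerate zero of a smooth family moves smoothly with the parameter
(registered helper `helper_simpleZeroMoves` of line `cross-cap-laurent`, crux
`GromovRecognitionRelEnd`, item stmt-SmoothPoincare4-11009)

In the glue of the bi-foliation the point where a leaf `U a` of a smooth family of `J`-spheres meets
the sphere at infinity is the simple zero of `z ↦ T (U a z)`.  This file is the flat implicit
function theorem making that zero depend smoothly on the parameter `a`: for `Φ : ℂ × ℂ → ℂ` smooth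
(over `ℝ`) on an open `O ∋ (0, z₀)` with `Φ (0, z₀) = 0` and bijective partial derivative
`fderiv ℝ (fun z ↦ Φ (0, z)) z₀`, there is `ζ`, smooth on a ball `‖a‖ < ρ`, with `ζ 0 = z₀`,
`Φ (a, ζ a) = 0`, graph inside `O` and within `r` of `z₀`, and every zero of `Φ` in the box
`‖a‖ < ρ`, `‖z - z₀‖ < r` lies on the graph.

Proof: `ζ` is Mathlib's implicit function `ContDiffAt.implicitFunction` of `Φ` at `(0, z₀)`
(the partial derivative is `fderiv ℝ Φ (0, z₀) ∘L inr`, invertible because a bijective continuous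
linear map between Banach spaces is); `ζ 0 = z₀`, `Φ (a, ζ a) = 0` near `0` and the local
uniqueness `Φ v = 0 ↔ ζ v.1 = v.2` near `(0, z₀)` are Mathlib's
`implicitFunction_apply_self` / `eventually_apply_implicitFunction` /
`eventually_apply_eq_iff_implicitFunction`; smoothness on a whole ball (not only `ContDiffAt` at
`0`, which for `n = ∞` is weaker) is `Literature.Analysis.Calculus.contDiffOn_implicitFunction_nhds`
applied to the underlying `ImplicitFunctionData`.  The radii are then read off in the sup metric of
`ℂ × ℂ`.
-/

-- the prescribed namespace `Summit.<P>.<Sub>.…` duplicates `SmoothPoincare4` (P = Sub)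
set_option linter.dupNamespace false

namespace Summit.SmoothPoincare4.SmoothPoincare4.Theorems.GromovRecognitionRelEnd.CrossCapLaurent

open Set Function Filter
open scoped ContDiff Topology

/-- A bijective continuous linear map between Banach spaces is invertible
(`ContinuousLinearMap.IsInvertible`, i.e. underlies a `ContinuousLinearEquiv`), by the open
mapping theorem (`ContinuousLinearEquiv.ofBijective`). -/
theorem isInvertible_of_bijective_simpleZero {E F : Type*} [NormedAddCommGroup E] [NormedSpace ℝ E]
    [CompleteSpace E] [NormedAddCommGroup F] [NormedSpace ℝ F] [CompleteSpace F] {L : E →L[ℝ] F}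
    (hL : Bijective L) : L.IsInvertible :=
  ⟨ContinuousLinearEquiv.ofBijective L (LinearMap.ker_eq_bot.2 hL.1)
      (LinearMap.range_eq_top.2 hL.2),
    ContinuousLinearEquiv.coe_ofBijective _ _ _⟩

/-- **A non-degenerate zero of a smooth family of plane maps moves smoothly with the parameter**
(implicit function theorem with local uniqueness, flat real calculus on `ℂ × ℂ`).  Let
`Φ : ℂ × ℂ → ℂ` be `C^∞` over `ℝ` on the open set `O ∋ (0, z₀)`, `Φ (0, z₀) = 0`, with bijective
partial derivative `fderiv ℝ (fun z ↦ Φ (0, z)) z₀`.  Then there are `ζ : ℂ → ℂ` and radii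
`ρ, r > 0` with `ζ 0 = z₀`, `ζ` smooth on the ball `‖a‖ < ρ`, `(a, ζ a) ∈ O`, `‖ζ a - z₀‖ < r` and
`Φ (a, ζ a) = 0` for `‖a‖ < ρ`, and every zero `(a, z)` of `Φ` with `‖a‖ < ρ`, `‖z - z₀‖ < r` has
`z = ζ a`. -/
theorem helper_simpleZeroMoves : ∀ (Φ : ℂ × ℂ → ℂ) (z₀ : ℂ) (O : Set (ℂ × ℂ)),
    IsOpen O → ((0 : ℂ), z₀) ∈ O → ContDiffOn ℝ ∞ Φ O → Φ (0, z₀) = 0 →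
    Bijective (fderiv ℝ (fun z : ℂ => Φ (0, z)) z₀) →
    ∃ (ζ : ℂ → ℂ) (ρ r : ℝ), 0 < ρ ∧ 0 < r ∧ ζ 0 = z₀ ∧
      ContDiffOn ℝ ∞ ζ (Metric.ball 0 ρ) ∧
      (∀ a : ℂ, ‖a‖ < ρ → (a, ζ a) ∈ O ∧ ‖ζ a - z₀‖ < r ∧ Φ (a, ζ a) = 0) ∧
      (∀ a z : ℂ, ‖a‖ < ρ → ‖z - z₀‖ < r → (a, z) ∈ O → Φ (a, z) = 0 → z = ζ a) := by
  intro Φ z₀ O hO hmem hΦ h0 hbij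
  have hOn : O ∈ 𝓝 ((0 : ℂ), z₀) := hO.mem_nhds hmem
  have hcd : ContDiffAt ℝ ∞ Φ ((0 : ℂ), z₀) := hΦ.contDiffAt hOn
  have hn : (∞ : ℕ∞ω) ≠ 0 := by simp
  have hdiff : DifferentiableAt ℝ Φ ((0 : ℂ), z₀) := hcd.differentiableAt hn
  -- the partial derivative in `z` is the total derivative composed with `inr`
  have hpartial : HasFDerivAt (fun z : ℂ => Φ (0, z))
      (fderiv ℝ Φ ((0 : ℂ), z₀) ∘L ContinuousLinearMap.inr ℝ ℂ ℂ) z₀ :=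
    hdiff.hasFDerivAt.comp z₀ (hasFDerivAt_prodMk_right (0 : ℂ) z₀)
  have if₂ : (fderiv ℝ Φ ((0 : ℂ), z₀) ∘L ContinuousLinearMap.inr ℝ ℂ ℂ).IsInvertible := by
    rw [← hpartial.fderiv]
    exact isInvertible_of_bijective_simpleZero hbij
  -- Mathlib's implicit function and its pointwise properties
  set ψ : ℂ → ℂ := hcd.implicitFunction hn if₂ with hψ
  have hψ0 : ψ 0 = z₀ := hcd.implicitFunction_apply_self hn if₂
  have hzero : ∀ᶠ a in 𝓝 (0 : ℂ), Φ (a, ψ a) = 0 := by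
    have h := hcd.eventually_apply_implicitFunction hn if₂
    rw [h0] at h
    exact h
  have huniq : ∀ᶠ v in 𝓝 ((0 : ℂ), z₀), Φ v = 0 ↔ ψ v.1 = v.2 := by
    have h := hcd.eventually_apply_eq_iff_implicitFunction hn if₂
    rw [h0] at h
    exact h
  have hcont : ContinuousAt ψ 0 := (hcd.contDiffAt_implicitFunction hn if₂).continuousAt
  -- smoothness on a whole neighbourhood of `0`
  have hsmooth : ∃ ρ₂ > 0, ContDiffOn ℝ ∞ ψ (Metric.ball 0 ρ₂) := by
    set φ := (hcd.hasStrictFDerivAt hn).implicitFunctionDataOfProdDomain if₂ with hφ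
    obtain ⟨T, hTo, hptT, hTsmooth, -, -⟩ :=
      Literature.Analysis.Calculus.contDiffOn_implicitFunction_nhds φ hn (U := O) hOn hΦ
        contDiffOn_fst
    have hpt : φ.prodFun φ.pt = (Φ ((0 : ℂ), z₀), (0 : ℂ)) := rfl
    have hψeq : ψ = fun x : ℂ => (uncurry φ.implicitFunction (Φ ((0 : ℂ), z₀), x)).2 := rfl
    have hιc : ContDiff ℝ ∞ fun x : ℂ => ((Φ ((0 : ℂ), z₀), x) : ℂ × ℂ) :=
      contDiff_const.prodMk contDiff_id
    have hpre : (fun x : ℂ => ((Φ ((0 : ℂ), z₀), x) : ℂ × ℂ)) ⁻¹' T ∈ 𝓝 (0 : ℂ) := by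
      refine hιc.continuous.continuousAt.preimage_mem_nhds (hTo.mem_nhds ?_)
      rw [← hpt]
      exact hptT
    obtain ⟨ρ₂, hρ₂, hball⟩ := Metric.mem_nhds_iff.1 hpre
    refine ⟨ρ₂, hρ₂, ?_⟩
    rw [hψeq]
    exact (hTsmooth.comp hιc.contDiffOn fun x hx => hball hx).snd
  obtain ⟨ρ₂, hρ₂, hψsmooth⟩ := hsmooth
  -- the box `‖a‖ < ε`, `‖z - z₀‖ < ε` inside `O` on which zeros of `Φ` lie on the graph of `ψ`
  obtain ⟨ε, hε, hbox⟩ := Metric.eventually_nhds_iff.1 (huniq.and (hO.eventually_mem hmem))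
  have hbox' : ∀ a z : ℂ, ‖a‖ < ε → ‖z - z₀‖ < ε →
      ((Φ (a, z) = 0 ↔ ψ a = z) ∧ (a, z) ∈ O) := by
    intro a z ha hz
    refine hbox (y := (a, z)) ?_
    rw [Prod.dist_eq, dist_zero_right, dist_eq_norm]
    exact max_lt ha hz
  -- near `0` the graph stays in the box and in the zero set
  have hnear : ∀ᶠ a in 𝓝 (0 : ℂ), Φ (a, ψ a) = 0 ∧ ‖ψ a - z₀‖ < ε := by
    refine hzero.and ?_
    have h : ∀ᶠ w in 𝓝 z₀, ‖w - z₀‖ < ε := by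
      rw [Metric.eventually_nhds_iff]
      exact ⟨ε, hε, fun w hw => by rwa [dist_eq_norm] at hw⟩
    have hc : Tendsto ψ (𝓝 0) (𝓝 z₀) := by
      have := hcont.tendsto
      rwa [hψ0] at this
    exact hc.eventually h
  obtain ⟨ρ₃, hρ₃, hnear'⟩ := Metric.eventually_nhds_iff.1 hnear
  -- assemble
  refine ⟨ψ, min ε (min ρ₂ ρ₃), ε, lt_min hε (lt_min hρ₂ hρ₃), hε, hψ0, ?_, ?_, ?_⟩
  · exact hψsmooth.mono (Metric.ball_subset_ball ((min_le_right _ _).trans (min_le_left _ _)))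
  · intro a ha
    have haε : ‖a‖ < ε := lt_of_lt_of_le ha (min_le_left _ _)
    have ha₃ : ‖a‖ < ρ₃ := lt_of_lt_of_le ha ((min_le_right _ _).trans (min_le_right _ _))
    obtain ⟨hz, hr⟩ := hnear' (y := a) (by rwa [dist_zero_right])
    exact ⟨(hbox' a (ψ a) haε hr).2, hr, hz⟩
  · intro a z ha hz _ hΦz
    have haε : ‖a‖ < ε := lt_of_lt_of_le ha (min_le_left _ _)
    exact (((hbox' a z haε hz).1).1 hΦz).symm

end Summit.SmoothPoincare4.SmoothPoincare4.Theorems.GromovRecognitionRelEnd.CrossCapLaurent
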